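import Summits.QuantumFields.BalabanUV.Beta.CompositeCorrectorForms
import Summits.QuantumFields.BalabanUV.Beta.CombRootedAbsorbsSym
import Summits.QuantumFields.BalabanUV.Beta.GAN24.PiBmConstants

/-!
# `BalabanUV.Beta.FP.TowerDoorUniformDataCorrector` — binder row D1, the row's ONE file, LEMMA U (J-NOTE-19 §4 U1, J-NOTE-20 §6), FORM-LEVEL PIECE:
# **THE COMPOSITE CORRECTOR `Ψ̂_m` FIXES EVERY 1-FORM SUPPORTED ON THE BONDS CROSSING THE `L^m`-FACES** — in particular the block-mean axial image of uniform data
# `Π^ρ_bm (κ ↦ c κ) = N·c·𝟙{bonds crossing an N-face}` (`N = L^m`; the TREE's `GAN24.PiBmConstants.axProjBmAt_const` over the row's gen-42 `GaugeMultiplierBlockMean.axProjBmAt_dz`)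
# — so the one-shot chart sends uniform data to the SAME comb representative as `Π_bm` alone
# (β-function cell `pub-balaban`, BINDER-OWNERS row D1 ∕ (C1) OWNER «beta-an2» gen 76, PART 50; PART 49 `TowerDoorUniformDataProjector` WITHDRAWN as a restatement of those two tree theorems)

WHY (located; J-NOTE-19 §4 «(U1) … `Ψ̂`'s correction vanishes on a field that is zero inside every `L`-block»; by value K2L-LAM Λ constant 4∕4, zero weight).  The corrector is
`Ψ_m A = A + |box (L^m)|⁻¹ • dz (ext (L^m) (ζ_m A))` (`CompositeCorrectorForms.corrPsi`) with the defect potential `ζ_{k+1} A = blockSum L (ζ_k A + λ^{r_k}_{𝒜_k A})`,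
`𝒜_{k+1} A = linAvgAt (r_k) (𝒜_k A) L` (`CompositeAveragingCoarseExact.compDefectAt ∕ compLinAvgAt`).  Call a 1-form FACE-SUPPORTED AT SCALE `M` when it vanishes on every bond interior
to an `M`-block (`blk M (z + e_κ) = blk M z ⟹ A κ z = 0`; displayed inline, no `def`).  Then: (1) the rooted tree gauge at scale `N` reads only intra-block bonds (`CombRootedAbsorbsSym.treeGaugeAt_congr`),
so it VANISHES on a form face-supported at scale `N` (§1) and such a form is rooted-axial; (2) one averaging step sends «face-supported at scale `L^(k+1)`» to «face-supported at scale `L^k`» on the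
coarse lattice: the rooted linearised average is the straight contour sum on rooted-axial forms (lit `linAvgAt_eq_straightSum_of_axialGaugeAt`), and every fine bond of the straight `μ`-contour over
the coarse bond `(μ, y)` lies in the fine window `L•y + box + [0, L)•e_μ`, whose `L^(k+1)`-block is constant as soon as `y` and `y + e_μ` share their `L^k`-block (§2, integer bookkeeping);
(3) by induction every `ζ_k A = 0`, `k ≤ m`, for `A` face-supported at scale `L^m` (§3), hence `Ψ_m A = A` and `Φ_m A = A` (§4).

WHAT ([folklore] finite-sum ∕ integer bookkeeping BY NAME; no `def`, no `def … : Prop`, nothing cited, 0 sorry; dimension `d + 1`, `L ≥ 1`, in-block roots):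
§1 `treeGaugeAt_zero_form`, **`treeGaugeAt_eq_zero_of_faceSupported`**, `axialGaugeAt_of_faceSupported`; §2 `ediv_eq_of_block_bounds`, `block_bounds_of_ediv_eq`, `blk_pow_succ_window`
(the window lemma), **`contourSum_eq_zero_of_faceSupported`**, **`linAvgAt_faceSupported_descends`**; §3 **`compLinAvgAt_faceSupported`**, **`compDefectAt_eq_zero_of_faceSupported`**;
§4 **`corrPsi_eq_self_of_faceSupported`**, `corrPhi_eq_self_of_faceSupported`, and the uniform-data instances **`corrPsi_axProjBmAt_const`** (`Ψ_m (Π^ρ_bm (κ ↦ c κ)) = Π^ρ_bm (κ ↦ c κ)` at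
`N = L^m`, the tree's `PiBmConstants.axProjBmAt_const_apply` + `blk_add_unitVec_apply` BY NAME) and `corrPsi_faceIndicator` (the same in the `grad (blockMeanAt ·)` shape of `axProjBmAt_dz`:
`Ψ_m` fixes `(κ, x) ↦ c·(blk (L^m) (x + e_κ) μ − blk (L^m) x μ)`).
WHAT THIS IS NOT: not U1 at the KERNEL letter (the junction `AN`'s column = `Ψ̂ (Π_bm (ℋ-column))` as kernels, and the straight column sum = constant connection by lit affine reproduction — next pieces),
not U2, not LEMMA U; the door NOT defined; nothing of Bałaban's asserted, valued or discharged; 0 estimates; 0∕4 row-D1 binders (hW, hR, D1Tel, D1Rep); v10 NOT filed; v9 p617999 stands; NOT (C1), NOT (T-ID), NOT D1,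
NEVER «G-an2-4 closed», NOT BetaPertH, NOT continuum, NOT Clay.

HONEST DEPENDENCY (page 1, mandatory): continuum YM on T⁴ ⇐ BetaPertH ∧ nine spine estimates (0/9 proved); BetaPertH ⇐ (D1) ∧ (D4) ∧ CAP+tail;
G-an2-4 gates asym, D1 and NE2/3/4.  HONEST FRAMING (cell contract, verbatim): «discharging `BetaPertH` makes Bałaban's UV stability UNCONDITIONAL —
a real constructive-QFT result; it is NOT the continuum limit and NOT the Clay problem.»  ABSOLUTE RULE (cell charter, verbatim): «No internally-minted
statement may enter as a cited fact. Every hypothesis is either kernel-proved in this package or a verbatim quotation of a PUBLISHED theorem with page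
reference. The manuscript(s) under audit are NOT citable for their own disputed steps — they are the thing under adjudication; programme-internal
(2001/route/tribunal) claims are never citable.»  Row D1 ∕ (C1) OWNER «beta-an2» gen 76, 2026-08-29.  No existing file touched.
-/

noncomputable section

open Finset
open scoped BigOperators
open Literature.MathematicalPhysics.QuantumFieldTheory
open Literature.MathematicalPhysics.QuantumFieldTheory.Balaban1983to89
open Literature.MathematicalPhysics.QuantumFieldTheory.Balaban1983to89.Beta
open AffineAveraging (Form0 Form1 Site box toSite unitVec unitVec_apply dz blockSum contourSum)
open AveragingContours (blk blk_block axial straightSum straightSum_eq_contourSum)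
open AveragingContoursRooted (linAvgAt treeGaugeAt AxialGaugeAt linAvgAt_eq_straightSum_of_axialGaugeAt)
open Summit.QuantumFields.BalabanUV.Beta.CompositeAveragingCoarseExact (compLinAvgAt compDefectAt compLinAvgAt_zero compLinAvgAt_succ compDefectAt_zero compDefectAt_succ)
open Summit.QuantumFields.BalabanUV.Beta.CompositeCorrectorForms (ext corrPsi corrPhi treeGaugeAt_sub blockSum_zero)
open Summit.QuantumFields.BalabanUV.Beta.CombRootedAbsorbsSym (treeGaugeAt_congr)
open Summit.QuantumFields.BalabanUV.Beta.AxialProjectorBlockMean (axProjBmAt)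
open Summit.QuantumFields.BalabanUV.Beta.GAN24.PiBmConstants (axProjBmAt_const_apply blk_add_unitVec_apply)

namespace Summit.QuantumFields.BalabanUV.Beta.FP.TowerDoorUniformDataCorrector

variable {d : ℕ}

/-! ## §1 Face-supported forms have no tree gauge and are rooted-axial -/

section Tree

/-- [folklore] the tree gauge of the zero form vanishes. -/
theorem treeGaugeAt_zero_form (ρ : Site (d + 1)) (L : ℕ) : treeGaugeAt ρ (0 : Form1 (d + 1) ℝ) L = 0 := by
  have h := treeGaugeAt_sub ρ (0 : Form1 (d + 1) ℝ) 0 L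
  rwa [sub_self, sub_self] at h

/-- [folklore] **A FORM VANISHING ON EVERY BOND INTERIOR TO AN `N`-BLOCK HAS ZERO ROOTED TREE GAUGE** (in-block root): the tree integral reads only intra-block bonds
(`treeGaugeAt_congr`). -/
theorem treeGaugeAt_eq_zero_of_faceSupported {N : ℕ} (hN : 1 ≤ N) {r : Fin (d + 1) → ℕ} (hr : r ∈ box (d + 1) N) {A : Form1 (d + 1) ℝ}
    (hA : ∀ (κ : Fin (d + 1)) (z : Site (d + 1)), blk N (z + unitVec κ) = blk N z → A κ z = 0) (x : Site (d + 1)) :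
    treeGaugeAt (toSite r) A N x = 0 := by
  rw [treeGaugeAt_congr hN hr (A' := (0 : Form1 (d + 1) ℝ)) (fun κ z hz hz' => by rw [hA κ z (hz'.trans hz.symm)]; rfl)]
  exact congrFun (treeGaugeAt_zero_form _ _) x

/-- [folklore] … hence it is in the rooted axial gauge at scale `N`. -/
theorem axialGaugeAt_of_faceSupported {N : ℕ} (hN : 1 ≤ N) {r : Fin (d + 1) → ℕ} (hr : r ∈ box (d + 1) N) {A : Form1 (d + 1) ℝ}
    (hA : ∀ (κ : Fin (d + 1)) (z : Site (d + 1)), blk N (z + unitVec κ) = blk N z → A κ z = 0) :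
    AxialGaugeAt (toSite r) A N := by
  intro y b hb
  have h := treeGaugeAt_eq_zero_of_faceSupported hN hr hA ((N : ℤ) • y + toSite b)
  unfold AveragingContoursRooted.treeGaugeAt at h
  rwa [blk_block y hb] at h

end Tree

/-! ## §2 One averaging step lowers the face scale by one power of `L` -/

section Window

/-- [folklore] integer division on a block: `M·B ≤ a < M·(B+1)` gives `a / M = B` (`0 < M`). -/
theorem ediv_eq_of_block_bounds {M B a : ℤ} (hM : 0 < M) (h1 : M * B ≤ a) (h2 : a < M * (B + 1)) : a / M = B := by
  apply le_antisymm
  · have : a / M < B + 1 := by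
      rw [Int.ediv_lt_iff_lt_mul hM]; linarith [mul_comm M (B + 1)]
    omega
  · rw [Int.le_ediv_iff_mul_le hM]; linarith [mul_comm B M]

/-- [folklore] … and conversely `a / M = B` gives `M·B ≤ a < M·(B+1)`. -/
theorem block_bounds_of_ediv_eq {M B a : ℤ} (hM : 0 < M) (h : a / M = B) : M * B ≤ a ∧ a < M * (B + 1) := by
  constructor
  · have := Int.ediv_mul_le a (ne_of_gt hM); rw [h] at this; linarith [mul_comm B M]
  · have := Int.lt_ediv_add_one_mul_self a hM; rw [h] at this; linarith [mul_comm (B + 1) M]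

/-- [folklore] **THE WINDOW LEMMA**: if `y` and `y + e_μ` share their `L^k`-block, then every fine point `w` with `L•y ≤ w ≤ L•y + (L−1) + L·e_μ` coordinatewise
(the window swept by the straight `μ`-contours of the `L`-blocks over `y`, one bond further) has `blk (L^(k+1)) w = blk (L^k) y`. -/
theorem blk_pow_succ_window {L : ℕ} (hL : 1 ≤ L) (k : ℕ) (μ : Fin (d + 1)) {y : Site (d + 1)}
    (hy : blk (L ^ k) (y + unitVec μ) = blk (L ^ k) y) {w : Site (d + 1)}
    (hlo : ∀ i, (L : ℤ) * y i ≤ w i) (hhi : ∀ i, w i ≤ (L : ℤ) * y i + ((L : ℤ) - 1) + (if i = μ then (L : ℤ) else 0)) :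
    blk (L ^ (k + 1)) w = blk (L ^ k) y := by
  have hLz : (0 : ℤ) < (L : ℤ) := by exact_mod_cast hL
  have hLk : (0 : ℤ) < ((L ^ k : ℕ) : ℤ) := by exact_mod_cast pow_pos hL k
  funext i
  simp only [blk]
  set B : ℤ := y i / ((L ^ k : ℕ) : ℤ) with hB
  obtain ⟨hB1, hB2⟩ := block_bounds_of_ediv_eq hLk hB.symm
  -- the upper end of the window: `y i + [i = μ]` is still in the block `B`
  have hB3 : y i + (if i = μ then 1 else 0) < ((L ^ k : ℕ) : ℤ) * (B + 1) := by
    by_cases hi : i = μ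
    · subst hi
      have e := congrFun hy i
      simp only [blk, Pi.add_apply, unitVec_apply, if_true] at e
      obtain ⟨-, h2⟩ := block_bounds_of_ediv_eq hLk (e.trans hB.symm)
      simpa using h2
    · rw [if_neg hi, add_zero]; exact hB2
  have hpow : ((L ^ (k + 1) : ℕ) : ℤ) = (L : ℤ) * ((L ^ k : ℕ) : ℤ) := by push_cast; ring
  rw [hpow]
  apply ediv_eq_of_block_bounds (mul_pos hLz hLk)
  · calc (L : ℤ) * ((L ^ k : ℕ) : ℤ) * B = (L : ℤ) * (((L ^ k : ℕ) : ℤ) * B) := by ring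
      _ ≤ (L : ℤ) * y i := mul_le_mul_of_nonneg_left hB1 hLz.le
      _ ≤ w i := hlo i
  · have h4 : y i + (if i = μ then 1 else 0) + 1 ≤ ((L ^ k : ℕ) : ℤ) * (B + 1) := by omega
    have h5 : (L : ℤ) * (y i + (if i = μ then 1 else 0) + 1) ≤ (L : ℤ) * (((L ^ k : ℕ) : ℤ) * (B + 1)) :=
      mul_le_mul_of_nonneg_left h4 hLz.le
    have h6 := hhi i
    have h7 : w i < (L : ℤ) * (y i + (if i = μ then 1 else 0) + 1) := by
      by_cases hi : i = μ
      · rw [if_pos hi] at h6 ⊢; linarith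
      · rw [if_neg hi] at h6 ⊢; linarith
    calc w i < (L : ℤ) * (y i + (if i = μ then 1 else 0) + 1) := h7
      _ ≤ (L : ℤ) * (((L ^ k : ℕ) : ℤ) * (B + 1)) := h5
      _ = (L : ℤ) * ((L ^ k : ℕ) : ℤ) * (B + 1) := by ring

/-- [folklore] **ONE STRAIGHT CONTOUR SUM OF A FACE-SUPPORTED FORM VANISHES OFF THE COARSE FACES**: for `A` face-supported at scale `L^(k+1)` and a coarse bond `(μ, y)` interior to an
`L^k`-block of the coarse lattice, `contourSum L A μ y = 0` (every fine bond of the contour and its successor lie in the window of `blk_pow_succ_window`). -/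
theorem contourSum_eq_zero_of_faceSupported {L : ℕ} (hL : 1 ≤ L) (k : ℕ) {A : Form1 (d + 1) ℝ}
    (hA : ∀ (κ : Fin (d + 1)) (z : Site (d + 1)), blk (L ^ (k + 1)) (z + unitVec κ) = blk (L ^ (k + 1)) z → A κ z = 0)
    (μ : Fin (d + 1)) (y : Site (d + 1)) (hy : blk (L ^ k) (y + unitVec μ) = blk (L ^ k) y) :
    contourSum L A μ y = 0 := by
  unfold AffineAveraging.contourSum
  refine Finset.sum_eq_zero fun b hb => Finset.sum_eq_zero fun s hs => hA μ _ ?_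
  have hb' : ∀ i, b i < L := by simpa [AffineAveraging.box, Fintype.mem_piFinset, Finset.mem_range] using hb
  have hs' : s < L := Finset.mem_range.1 hs
  set z : Site (d + 1) := (L : ℤ) • y + toSite b + (s : ℤ) • unitVec μ with hz
  have hzi : ∀ i, z i = (L : ℤ) * y i + (b i : ℤ) + (if i = μ then (s : ℤ) else 0) := by
    intro i; simp only [hz, Pi.add_apply, Pi.smul_apply, smul_eq_mul, AffineAveraging.toSite, unitVec_apply]
    split_ifs <;> ring
  have h1 : blk (L ^ (k + 1)) (z + unitVec μ) = blk (L ^ k) y := by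
    apply blk_pow_succ_window hL k μ hy
    · intro i; rw [Pi.add_apply, hzi i, unitVec_apply]
      have := hb' i; split_ifs <;> omega
    · intro i; rw [Pi.add_apply, hzi i, unitVec_apply]
      have := hb' i; have := hs'
      by_cases hi : i = μ
      · subst hi; simp only [if_true]; omega
      · simp only [if_neg hi]; omega
  have h2 : blk (L ^ (k + 1)) z = blk (L ^ k) y := by
    apply blk_pow_succ_window hL k μ hy
    · intro i; rw [hzi i]; have := hb' i; split_ifs <;> omega
    · intro i; rw [hzi i]; have := hb' i; have := hs'
      by_cases hi : i = μ
      · subst hi; simp only [if_true]; omega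
      · simp only [if_neg hi]; omega
  rw [h1, h2]

/-- [folklore] **`linAvgAt_faceSupported_descends` — ONE AVERAGING STEP LOWERS THE FACE SCALE**: if `A` is face-supported at scale `L^(k+1)`, its rooted linearised average
`linAvgAt (toSite r) A L` (in-block root) is face-supported at scale `L^k` on the coarse lattice (`A` is rooted-axial at scale `L` by §1, so the average is the straight contour sum, then §2). -/
theorem linAvgAt_faceSupported_descends {L : ℕ} (hL : 1 ≤ L) {r : Fin (d + 1) → ℕ} (hr : r ∈ box (d + 1) L) (k : ℕ) {A : Form1 (d + 1) ℝ}
    (hA : ∀ (κ : Fin (d + 1)) (z : Site (d + 1)), blk (L ^ (k + 1)) (z + unitVec κ) = blk (L ^ (k + 1)) z → A κ z = 0)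
    (μ : Fin (d + 1)) (y : Site (d + 1)) (hy : blk (L ^ k) (y + unitVec μ) = blk (L ^ k) y) :
    linAvgAt (toSite r) A L μ y = 0 := by
  -- face-supported at scale `L^(k+1)` ⟹ face-supported at scale `L` ⟹ rooted-axial at scale `L`
  have hA1 : ∀ (κ : Fin (d + 1)) (z : Site (d + 1)), blk L (z + unitVec κ) = blk L z → A κ z = 0 := by
    intro κ z hz
    apply hA κ z
    have hw : ∀ w : Site (d + 1), blk (L ^ (k + 1)) w = blk (L ^ k) (blk L w) := fun w =>
      CompositeCorrectorForms.blk_blk (by omega) k w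
    rw [hw, hw, hz]
  have hax : AxialGaugeAt (toSite r) A L := axialGaugeAt_of_faceSupported hL hr hA1
  rw [linAvgAt_eq_straightSum_of_axialGaugeAt hax, straightSum_eq_contourSum]
  exact contourSum_eq_zero_of_faceSupported hL k hA μ y hy

end Window

/-! ## §3 The composite averaging and the defect potential on face-supported forms -/

section Composite

variable {L : ℕ} (hL : 1 ≤ L) (r : ℕ → (Fin (d + 1) → ℕ)) (hr : ∀ k, r k ∈ box (d + 1) L)
include hL hr

/-- [folklore] **`compLinAvgAt_faceSupported`**: for `A` face-supported at scale `L^m` and `k ≤ m`, the `k`-fold composite average `𝒜_k A` is face-supported at scale `L^(m−k)`. -/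
theorem compLinAvgAt_faceSupported (m : ℕ) {A : Form1 (d + 1) ℝ}
    (hA : ∀ (κ : Fin (d + 1)) (z : Site (d + 1)), blk (L ^ m) (z + unitVec κ) = blk (L ^ m) z → A κ z = 0) :
    ∀ k, k ≤ m → ∀ (κ : Fin (d + 1)) (z : Site (d + 1)), blk (L ^ (m - k)) (z + unitVec κ) = blk (L ^ (m - k)) z →
      compLinAvgAt r L k A κ z = 0 := by
  intro k
  induction k with
  | zero => intro _ κ z hz; rw [compLinAvgAt_zero]; exact hA κ z (by simpa using hz)
  | succ k ih =>
    intro hk κ z hz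
    rw [compLinAvgAt_succ]
    have hk' : k ≤ m := by omega
    have e : m - k = (m - (k + 1)) + 1 := by omega
    have ih' : ∀ (κ : Fin (d + 1)) (z : Site (d + 1)), blk (L ^ ((m - (k + 1)) + 1)) (z + unitVec κ) = blk (L ^ ((m - (k + 1)) + 1)) z →
        compLinAvgAt r L k A κ z = 0 := by
      intro κ' z' hz'; exact ih hk' κ' z' (by rw [e]; exact hz')
    exact linAvgAt_faceSupported_descends hL (hr k) (m - (k + 1)) ih' κ z hz

/-- [folklore] **`compDefectAt_eq_zero_of_faceSupported` — THE DEFECT POTENTIAL OF A FACE-SUPPORTED FORM VANISHES AT EVERY DEPTH `k ≤ m`**: each stage's tree gauge is taken at scale `L`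
of a form face-supported at scale `L^(m−k) ≥ L` (§1), and block sums of `0` are `0`. -/
theorem compDefectAt_eq_zero_of_faceSupported (m : ℕ) {A : Form1 (d + 1) ℝ}
    (hA : ∀ (κ : Fin (d + 1)) (z : Site (d + 1)), blk (L ^ m) (z + unitVec κ) = blk (L ^ m) z → A κ z = 0) :
    ∀ k, k ≤ m → compDefectAt r L k A = 0 := by
  intro k
  induction k with
  | zero => intro _; exact compDefectAt_zero r L A
  | succ k ih =>
    intro hk
    rw [compDefectAt_succ, ih (by omega)]
    -- the stage-`k` average is face-supported at scale `L^(m−k)` with `m − k ≥ 1`, hence at scale `L`; its tree gauge vanishes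
    have hface : ∀ (κ : Fin (d + 1)) (z : Site (d + 1)), blk L (z + unitVec κ) = blk L z → compLinAvgAt r L k A κ z = 0 := by
      intro κ z hz
      apply compLinAvgAt_faceSupported hL r hr m hA k (by omega) κ z
      have e : m - k = (m - k - 1) + 1 := by omega
      have hw : ∀ w : Site (d + 1), blk (L ^ (m - k)) w = blk (L ^ (m - k - 1)) (blk L w) := fun w => by
        rw [e]; exact CompositeCorrectorForms.blk_blk (by omega) (m - k - 1) w
      rw [hw, hw, hz]
    have ht : treeGaugeAt (toSite (r k)) (compLinAvgAt r L k A) L = 0 :=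
      funext fun x => treeGaugeAt_eq_zero_of_faceSupported hL (hr k) hface x
    rw [ht, zero_add, blockSum_zero]

end Composite

/-! ## §4 The correctors fix face-supported forms; the uniform-data instance -/

section Corrector

variable {L : ℕ} (hL : 1 ≤ L) (r : ℕ → (Fin (d + 1) → ℕ)) (hr : ∀ k, r k ∈ box (d + 1) L)
include hL hr

omit hL hr in
/-- [folklore] `dz (ext N 0) = 0`. -/
theorem dz_ext_zero (N : ℕ) : dz (ext N (0 : Form0 (d + 1) ℝ)) = 0 := by
  funext κ x; simp [AffineAveraging.dz, CompositeCorrectorForms.ext]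

/-- [folklore] **`corrPsi_eq_self_of_faceSupported` — `Ψ_m` FIXES EVERY FORM FACE-SUPPORTED AT SCALE `L^m`** (its defect potential vanishes, §3). -/
theorem corrPsi_eq_self_of_faceSupported (m : ℕ) {A : Form1 (d + 1) ℝ}
    (hA : ∀ (κ : Fin (d + 1)) (z : Site (d + 1)), blk (L ^ m) (z + unitVec κ) = blk (L ^ m) z → A κ z = 0) :
    corrPsi r L m A = A := by
  unfold CompositeCorrectorForms.corrPsi
  rw [compDefectAt_eq_zero_of_faceSupported hL r hr m hA m le_rfl, dz_ext_zero, smul_zero, add_zero]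

/-- [folklore] … and so does its inverse `Φ_m`. -/
theorem corrPhi_eq_self_of_faceSupported (m : ℕ) {A : Form1 (d + 1) ℝ}
    (hA : ∀ (κ : Fin (d + 1)) (z : Site (d + 1)), blk (L ^ m) (z + unitVec κ) = blk (L ^ m) z → A κ z = 0) :
    corrPhi r L m A = A := by
  unfold CompositeCorrectorForms.corrPhi
  rw [compDefectAt_eq_zero_of_faceSupported hL r hr m hA m le_rfl, dz_ext_zero, smul_zero, sub_zero]

/-- [folklore] **`corrPsi_axProjBmAt_const` — THE UNIFORM-DATA INSTANCE AT THE TREE's LETTER**: for every root offset `ρ` and constants `c`, `Ψ_m (Π^ρ_bm (κ ↦ c κ)) = Π^ρ_bm (κ ↦ c κ)`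
at `N = L^m` — `Π^ρ_bm` of a translation-invariant form is `N·c κ` on the bonds with `x_κ % N = N − 1` and `0` elsewhere (`PiBmConstants.axProjBmAt_const_apply`), and such a bond
leaves its block (`blk_add_unitVec_apply`), so the form is face-supported at scale `L^m`. -/
theorem corrPsi_axProjBmAt_const (m : ℕ) (ρ : Fin (d + 1) → ℤ) (c : Fin (d + 1) → ℝ) :
    corrPsi r L m (axProjBmAt ρ (L ^ m) (fun κ _ => c κ)) = axProjBmAt ρ (L ^ m) (fun κ _ => c κ) := by
  have hLm : 1 ≤ L ^ m := Nat.one_le_pow _ _ (by omega)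
  refine corrPsi_eq_self_of_faceSupported hL r hr m fun κ z hz => ?_
  rw [axProjBmAt_const_apply ρ hLm c κ z, if_neg]
  intro hf
  have e := congrFun hz κ
  rw [blk_add_unitVec_apply hLm z κ κ, if_pos ⟨rfl, hf⟩] at e
  omega

/-- [folklore] **`corrPsi_faceIndicator`** — the same instance in the `grad (blockMeanAt ·)` shape (`GaugeMultiplierBlockMean.axProjBmAt_dz`): `Ψ_m` fixes the face-indicator form
`(κ, x) ↦ c·(blk (L^m) (x + e_κ) μ − blk (L^m) x μ)`, which vanishes on every bond interior to an `L^m`-block by inspection. -/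
theorem corrPsi_faceIndicator (m : ℕ) (c : ℝ) (μ : Fin (d + 1)) :
    corrPsi r L m (fun κ x => c * (((blk (L ^ m) (x + unitVec κ) μ : ℤ) : ℝ) - ((blk (L ^ m) x μ : ℤ) : ℝ)))
      = fun κ x => c * (((blk (L ^ m) (x + unitVec κ) μ : ℤ) : ℝ) - ((blk (L ^ m) x μ : ℤ) : ℝ)) :=
  corrPsi_eq_self_of_faceSupported hL r hr m fun κ z hz => by simp only [hz, sub_self, mul_zero]

end Corrector

end Summit.QuantumFields.BalabanUV.Beta.FP.TowerDoorUniformDataCorrector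

end
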